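import Summits.CriticalPhenomena.PercolationContinuityZ3.Theorems.FK.PressureVanHoveCovering
import Summits.CriticalPhenomena.PercolationContinuityZ3.Theorems.FK.InfiniteVolumeDefs
import Summits.CriticalPhenomena.PercolationContinuityZ3.Theorems.FK.LatticeEdgeCounting
import HarnessLib

/-!
# FK-continuity cell, FO-10a (pressure layer): the random-cluster pressure along VAN HOVE sequences and for arbitrary
# boundary wirings — Grimmett 2006, Thm. (4.58): the limit is "independent of `ξ` and of the way in which `Λ ↑ ℤ^d`"

Registered R96 (cell INBOX l.6711, 2026-08-24); registry row FO-10a-g339; label VHV-B (coordinator fk-4 g200).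
Cell `fk-continuity` (bschramm), row FO-10a; support file for the FK-continuity transplant
(`--supports stmt-CriticalPhenomena-4575`); builds on p205010 (kernel theorem, internal audit signed; external expert
review pending). Pure proofs; no definitions, no named facts, no sorries; general `d`.
UNCONDITIONAL structure (a limit statement from a limit hypothesis); it decides nothing about FH / TP_FK / `p_c(q)`.

From the covering estimate of `PressureVanHoveCovering.lean` and the van Hove filter of the tree
(`Literature … ThermodynamicLimit.vanHove d`: `Λ` eventually contains every finite set and `|∂ᵉˣΛ| ≤ ε|Λ|`):

* **`tendsto_log_rcPartitionFunction_div_card_vanHove`** — if `n^{-d} log Z⁰_{C_n}(p,q) → Φ` (the cube limit of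
  `PressureThermodynamicLimit.lean`) then `|Λ|⁻¹ log Z⁰_Λ(p,q) → Φ` as `Λ ↑ ℤ^d` in the sense of van Hove (`q ≥ 1`,
  `0 ≤ p ≤ 1`);
* `card_innerBoundary_le_two_mul_card_outerBoundary`, `abs_log_rcPartitionFunction_sub_free_le` — `|∂ⁱⁿΛ| ≤ 2d |∂ᵉˣΛ|` on
  `ℤ^d`, and `|log Z^B_Λ − log Z⁰_Λ| ≤ |B| log q` for every wired set `B` of a finite graph;
* **`tendsto_log_rcPartitionFunction_bc_div_card_vanHove`** — the same van Hove limit `Φ` for EVERY family of wired boundary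
  sets `B_Λ ⊆ ∂ⁱⁿΛ` (in the tree's vocabulary `B_Λ ⊆ wiredBoundary (zdGraph d) Λ`: the boundary conditions between free,
  `B_Λ = ∅`, and wired, `B_Λ = ∂ⁱⁿΛ`, that identify ONE subset of `∂ⁱⁿΛ`), in particular
  `tendsto_log_rcPartitionFunction_wired_div_card_vanHove`. Grimmett's general `ξ ∈ Ω` identifies the vertices of `∂Λ`
  along the clusters of `ξ` off `E_Λ`, i.e. along a PARTITION of `∂Λ`; the tree's `rcPartitionFunction G p q B` wires a
  single set `B`, so the statement here is the special case the tree has language for (the proof — `k¹ ≤ k^ξ ≤ k⁰`, cost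
  `≤ |∂Λ| log q = o(|Λ|)` — is the same for partitions).
  -- TODO(general form): boundary conditions given by an arbitrary partition of `∂ⁱⁿΛ` into wired classes.
* `tendsto_log_rcPartitionFunction_boxBC_div_card_of_cube` — back to the boxes `Λ_n = [-n,n]^d` with `boxBC d b n`
  (`tendsto_box_vanHove_holds`; consistency with `PressureThermodynamicLimit.lean`);
* `mul_card_sub_card_innerBoundary_le_card_edgesIn`, `tendsto_card_edgesIn_div_card_vanHove` — `d(|Λ| − |∂ⁱⁿΛ|) ≤ |E_Λ| ≤ d|Λ|`,
  so `|E_Λ|/|Λ| → d` along van Hove sequences; **`tendsto_log_rcPartitionFunction_bc_div_card_edgesIn_vanHove`** — Grimmett's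
  own normalisation (4.59)/(4.69): `|E_Λ|⁻¹ log Z^{B_Λ}_Λ(p,q) → Φ/d` along van Hove sequences (`d ≥ 1`).

Honest framing: thermodynamic-limit bookkeeping; no statement about `p_c(q)`; NOT a binder discharge, NOT `_r4`.

## References

* G. Grimmett, *The Random-Cluster Model*, Springer 2006 (`book:grimmett2006-random-cluster-model`): §4.5, Thm. (4.58)
  ("exist and are independent of `ξ ∈ Ω` and of the way in which `Λ ↑ ℤ^d`") and its proof, (4.65)–(4.70) [PDF pp. 88–92].
  [Grimmett2006]
* S. Friedli, Y. Velenik, *Statistical Mechanics of Lattice Systems*, CUP 2017, §3.2.1 and the proof of Thm. 3.6. [FriedliVelenik2017]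
-/

noncomputable section

open Finset Filter Topology

namespace Summit.CriticalPhenomena.PercolationContinuityZ3.Theorems.FK

open Literature.Probability.Percolation Literature.Probability.LatticeModels

variable {d : ℕ}

/-! ### The limit along van Hove sequences -/

/-- **Grimmett 2006, Thm. (4.58), "independent of the way in which `Λ ↑ ℤ^d`"** (free boundary condition): if the cube
pressures converge, `n^{-d} log Z⁰_{C_n}(p,q) → Φ` (`PressureThermodynamicLimit.lean`), then
`|Λ|⁻¹ log Z⁰_Λ(p,q) → Φ` as `Λ ↑ ℤ^d` in the sense of van Hove (`q ≥ 1`, `0 ≤ p ≤ 1`).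
[cite: Grimmett2006, Thm. (4.58)] -/
theorem tendsto_log_rcPartitionFunction_div_card_vanHove {p q : ℝ} (hp : p ∈ Set.Icc (0 : ℝ) 1) (hq : 1 ≤ q)
    {Φ : ℝ} (hΦ : Tendsto (fun n : ℕ =>
      Real.log (rcPartitionFunction (finsetGraph (zdGraph d) (halfOpenBox d n)) p q ∅) / (n : ℝ) ^ d) atTop (𝓝 Φ)) :
    Tendsto (fun Λ : Finset (Site d) =>
      Real.log (rcPartitionFunction (finsetGraph (zdGraph d) Λ) p q ∅) / (#Λ : ℝ)) (vanHove d) (𝓝 Φ) := by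
  set K : ℝ := Real.log q with hK
  have hK0 : 0 ≤ K := Real.log_nonneg hq
  rw [Metric.tendsto_nhds]
  intro ε hε
  -- choose the tile size `n`
  have hD : Tendsto (fun n : ℕ => K * (2 * d * ((((n : ℝ) + 2) ^ d - (n : ℝ) ^ d) / (n : ℝ) ^ d))) atTop (𝓝 0) := by
    have h := (tendsto_pow_add_two_sub_pow_div d tendsto_natCast_atTop_atTop).const_mul (K * (2 * d))
    rw [mul_zero] at h
    refine h.congr fun n => ?_
    ring
  have hε3 : 0 < ε / 3 := by positivity
  obtain ⟨n, hn1, hnΦ, hnD⟩ := ((eventually_ge_atTop 1).and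
    (((Metric.tendsto_nhds.1 hΦ) (ε / 3) hε3).and ((Metric.tendsto_nhds.1 hD) (ε / 3) hε3))).exists
  have hn : 0 < n := hn1
  have hN0 : (0 : ℝ) < (n : ℝ) ^ d := by positivity
  -- the van Hove condition with `δ`
  set M : ℝ := K * ((2 * d + 2) * (n : ℝ) ^ d) with hM
  have hM0 : 0 ≤ M := by positivity
  set δ : ℝ := ε / 3 / (M + 1) with hδ
  have hδ0 : 0 < δ := by positivity
  have hev := (tendsto_vanHove_iff.1 tendsto_id) δ hδ0 ({0} : Finset (Site d))
  filter_upwards [hev] with Λ hΛ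
  obtain ⟨h0, hbd⟩ := hΛ
  have hne : Λ.Nonempty := ⟨0, h0 (Finset.mem_singleton_self 0)⟩
  have hL0 : (0 : ℝ) < #Λ := by exact_mod_cast hne.card_pos
  have key := abs_log_rcPartitionFunction_div_card_sub_le hp hq hn hne (d := d)
  rw [Real.dist_eq] at hnΦ hnD ⊢
  rw [sub_zero] at hnD
  -- the boundary term is at most `M δ ≤ ε/3`
  have hb : K * ((2 * d + 2) * (n : ℝ) ^ d * #(outerBoundary (zdGraph d) Λ) / #Λ) ≤ ε / 3 := by
    have h1 : (#(outerBoundary (zdGraph d) Λ) : ℝ) / #Λ ≤ δ := by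
      rw [div_le_iff₀ hL0]; simpa using hbd
    calc K * ((2 * d + 2) * (n : ℝ) ^ d * #(outerBoundary (zdGraph d) Λ) / #Λ)
        = M * ((#(outerBoundary (zdGraph d) Λ) : ℝ) / #Λ) := by rw [hM]; ring
      _ ≤ M * δ := mul_le_mul_of_nonneg_left h1 hM0
      _ ≤ ε / 3 := by
          rw [hδ, mul_div_assoc']
          rw [div_le_iff₀ (by positivity)]
          nlinarith [hε3]
  have hD' : K * (2 * d * (((n : ℝ) + 2) ^ d - (n : ℝ) ^ d) / (n : ℝ) ^ d) < ε / 3 := by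
    have := (abs_lt.1 hnD).2
    calc K * (2 * d * (((n : ℝ) + 2) ^ d - (n : ℝ) ^ d) / (n : ℝ) ^ d)
        = K * (2 * d * ((((n : ℝ) + 2) ^ d - (n : ℝ) ^ d) / (n : ℝ) ^ d)) := by ring
      _ < ε / 3 := this
  calc |Real.log (rcPartitionFunction (finsetGraph (zdGraph d) Λ) p q ∅) / (#Λ : ℝ) - Φ|
      ≤ |Real.log (rcPartitionFunction (finsetGraph (zdGraph d) Λ) p q ∅) / (#Λ : ℝ) -
            Real.log (rcPartitionFunction (finsetGraph (zdGraph d) (halfOpenBox d n)) p q ∅) / (n : ℝ) ^ d| +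
          |Real.log (rcPartitionFunction (finsetGraph (zdGraph d) (halfOpenBox d n)) p q ∅) / (n : ℝ) ^ d - Φ| :=
        abs_sub_le _ _ _
    _ < (ε / 3 + ε / 3) + ε / 3 := by
        refine add_lt_add_of_le_of_lt (key.trans ?_) hnΦ
        rw [mul_add]
        exact add_le_add hb hD'.le
    _ = ε := by ring

/-! ### Arbitrary boundary wirings -/

/-- `|∂ⁱⁿΛ| ≤ 2d |∂ᵉˣΛ|` on `ℤ^d`: every inner boundary vertex is a neighbour of an outer boundary vertex, and a site has
at most `2d` neighbours. [folklore] -/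
theorem card_innerBoundary_le_two_mul_card_outerBoundary (Λ : Finset (Site d)) :
    #(innerBoundary (zdGraph d) Λ) ≤ 2 * d * #(outerBoundary (zdGraph d) Λ) := by
  classical
  have hsub : innerBoundary (zdGraph d) Λ ⊆ (outerBoundary (zdGraph d) Λ).biUnion fun y => (zdGraph d).neighborFinset y := by
    intro x hx
    rw [mem_innerBoundary_iff] at hx
    obtain ⟨hxΛ, y, hyΛ, hxy⟩ := hx
    rw [Finset.mem_biUnion]
    exact ⟨y, mem_outerBoundary_iff.2 ⟨hyΛ, x, hxΛ, hxy.symm⟩, (SimpleGraph.mem_neighborFinset _ _ _).2 hxy.symm⟩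
  calc #(innerBoundary (zdGraph d) Λ)
      ≤ #((outerBoundary (zdGraph d) Λ).biUnion fun y => (zdGraph d).neighborFinset y) := Finset.card_le_card hsub
    _ ≤ ∑ y ∈ outerBoundary (zdGraph d) Λ, #((zdGraph d).neighborFinset y) := Finset.card_biUnion_le
    _ ≤ ∑ _y ∈ outerBoundary (zdGraph d) Λ, 2 * d := Finset.sum_le_sum fun y _ => by
        rw [SimpleGraph.card_neighborFinset_eq_degree, ← SimpleGraph.card_incidenceFinset_eq_degree]
        exact card_incidenceFinset_zdGraph_le y
    _ = 2 * d * #(outerBoundary (zdGraph d) Λ) := by rw [Finset.sum_const, smul_eq_mul, mul_comm]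

/-- **Boundary conditions cost at most `log q` per wired vertex**: `|log Z^B_Λ − log Z⁰_Λ| ≤ |B| log q` for every wired
set `B` of a finite graph (`q ≥ 1`; Grimmett 2006, proof of Thm. (4.58): `Y⁰_Λ e^{-κ|∂Λ|} ≤ Y^ξ_Λ ≤ Y⁰_Λ`).
[cite: Grimmett2006, proof of Thm. (4.58)] -/
theorem abs_log_rcPartitionFunction_sub_free_le {V : Type*} [Fintype V] [DecidableEq V] (G : SimpleGraph V)
    [DecidableRel G.Adj] {p q : ℝ} (hp : p ∈ Set.Icc (0 : ℝ) 1) (hq : 1 ≤ q) (B : Finset V) :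
    |Real.log (rcPartitionFunction G p q (↑B : Set V)) - Real.log (rcPartitionFunction G p q ∅)| ≤
      #B * Real.log q := by
  have h := log_rcPartitionFunction_free_sub_wired_mem G hp hq B
  rw [abs_sub_comm, abs_of_nonneg h.1]
  refine h.2.trans (mul_le_mul_of_nonneg_right ?_ (Real.log_nonneg hq))
  exact max_le (by linarith) (Nat.cast_nonneg _)

/-- **Grimmett 2006, Thm. (4.58), "independent of `ξ`"**: along van Hove sequences the per-site pressure is the same
`Φ` for EVERY choice of wired boundary sets `B_Λ ⊆ ∂ⁱⁿΛ` (`B_Λ ⊆ wiredBoundary (zdGraph d) Λ`: the tree's vocabulary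
wires ONE subset of the inner vertex boundary — free `∅`, wired `∂ⁱⁿΛ`, or anything in between; Grimmett's general `ξ`
wires `∂Λ` along a partition, at the same cost `≤ |∂Λ| log q = o(|Λ|)`), given the cube limit
`n^{-d} log Z⁰_{C_n}(p,q) → Φ` (`q ≥ 1`, `0 ≤ p ≤ 1`). [cite: Grimmett2006, Thm. (4.58)] -/
theorem tendsto_log_rcPartitionFunction_bc_div_card_vanHove {p q : ℝ} (hp : p ∈ Set.Icc (0 : ℝ) 1) (hq : 1 ≤ q)
    {Φ : ℝ} (hΦ : Tendsto (fun n : ℕ =>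
      Real.log (rcPartitionFunction (finsetGraph (zdGraph d) (halfOpenBox d n)) p q ∅) / (n : ℝ) ^ d) atTop (𝓝 Φ))
    (B : ∀ Λ : Finset (Site d), Set ↥Λ) (hB : ∀ Λ, B Λ ⊆ wiredBoundary (zdGraph d) Λ) :
    Tendsto (fun Λ : Finset (Site d) =>
      Real.log (rcPartitionFunction (finsetGraph (zdGraph d) Λ) p q (B Λ)) / (#Λ : ℝ)) (vanHove d) (𝓝 Φ) := by
  classical
  set K : ℝ := Real.log q with hK
  have hK0 : 0 ≤ K := Real.log_nonneg hq
  have hfree := tendsto_log_rcPartitionFunction_div_card_vanHove hp hq hΦ (d := d)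
  -- the difference with the free pressure tends to `0`
  have hdiff : Tendsto (fun Λ : Finset (Site d) =>
      Real.log (rcPartitionFunction (finsetGraph (zdGraph d) Λ) p q (B Λ)) / (#Λ : ℝ) -
        Real.log (rcPartitionFunction (finsetGraph (zdGraph d) Λ) p q ∅) / (#Λ : ℝ)) (vanHove d) (𝓝 0) := by
    rw [Metric.tendsto_nhds]
    intro ε hε
    set δ : ℝ := ε / 2 / (2 * d * K + 1) with hδ
    have hδ0 : 0 < δ := by positivity
    filter_upwards [(tendsto_vanHove_iff.1 tendsto_id) δ hδ0 ({0} : Finset (Site d))] with Λ hΛ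
    obtain ⟨h0, hbd⟩ := hΛ
    have hne : Λ.Nonempty := ⟨0, h0 (Finset.mem_singleton_self 0)⟩
    have hL0 : (0 : ℝ) < #Λ := by exact_mod_cast hne.card_pos
    rw [Real.dist_eq, sub_zero, ← sub_div, abs_div, abs_of_pos hL0, div_lt_iff₀ hL0]
    -- `|log Z^B - log Z⁰| ≤ |B| K ≤ |∂ⁱⁿΛ| K ≤ 2d |∂ᵉˣΛ| K ≤ 2d K δ |Λ| < ε |Λ|`
    have hBfin : (B Λ).toFinset.map (Function.Embedding.subtype _) ⊆ innerBoundary (zdGraph d) Λ := by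
      intro x hx
      rw [Finset.mem_map] at hx
      obtain ⟨y, hy, rfl⟩ := hx
      exact (mem_wiredBoundary_iff y).1 (hB Λ (Set.mem_toFinset.1 hy))
    have hcardB : (#(B Λ).toFinset : ℝ) ≤ 2 * d * #(outerBoundary (zdGraph d) Λ) := by
      have h1 : #(B Λ).toFinset ≤ #(innerBoundary (zdGraph d) Λ) := by
        rw [← Finset.card_map (Function.Embedding.subtype _)]
        exact Finset.card_le_card hBfin
      exact_mod_cast h1.trans (card_innerBoundary_le_two_mul_card_outerBoundary Λ)
    have h2 := abs_log_rcPartitionFunction_sub_free_le (finsetGraph (zdGraph d) Λ) hp hq (B Λ).toFinset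
    rw [Set.coe_toFinset] at h2
    have h3 : (#(outerBoundary (zdGraph d) Λ) : ℝ) ≤ δ * #Λ := by simpa using hbd
    calc |Real.log (rcPartitionFunction (finsetGraph (zdGraph d) Λ) p q (B Λ)) -
            Real.log (rcPartitionFunction (finsetGraph (zdGraph d) Λ) p q ∅)|
        ≤ #(B Λ).toFinset * K := h2
      _ ≤ 2 * d * #(outerBoundary (zdGraph d) Λ) * K := mul_le_mul_of_nonneg_right hcardB hK0
      _ ≤ 2 * d * (δ * #Λ) * K := by
          refine mul_le_mul_of_nonneg_right (mul_le_mul_of_nonneg_left h3 (by positivity)) hK0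
      _ = (2 * d * K) * δ * #Λ := by ring
      _ < ε * #Λ := by
          refine mul_lt_mul_of_pos_right ?_ hL0
          rw [hδ, mul_div_assoc', div_lt_iff₀ (by positivity)]
          have hdKε : 0 ≤ (d : ℝ) * K * ε := mul_nonneg (mul_nonneg (Nat.cast_nonneg d) hK0) hε.le
          nlinarith [hε, hdKε]
  have h := hfree.add hdiff
  rw [add_zero] at h
  exact h.congr fun Λ => by ring

/-- **The wired boundary condition along van Hove sequences**: `|Λ|⁻¹ log Z¹_Λ(p,q) → Φ` (the whole inner vertex boundary
wired), given the cube limit. [cite: Grimmett2006, Thm. (4.58)] -/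
theorem tendsto_log_rcPartitionFunction_wired_div_card_vanHove {p q : ℝ} (hp : p ∈ Set.Icc (0 : ℝ) 1) (hq : 1 ≤ q)
    {Φ : ℝ} (hΦ : Tendsto (fun n : ℕ =>
      Real.log (rcPartitionFunction (finsetGraph (zdGraph d) (halfOpenBox d n)) p q ∅) / (n : ℝ) ^ d) atTop (𝓝 Φ)) :
    Tendsto (fun Λ : Finset (Site d) =>
      Real.log (rcPartitionFunction (finsetGraph (zdGraph d) Λ) p q (wiredBoundary (zdGraph d) Λ)) / (#Λ : ℝ))
      (vanHove d) (𝓝 Φ) :=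
  tendsto_log_rcPartitionFunction_bc_div_card_vanHove hp hq hΦ (fun Λ => wiredBoundary (zdGraph d) Λ)
    fun _ => subset_rfl

/-- **Back to the boxes `Λ_n = [-n,n]^d`** (consistency with `PressureThermodynamicLimit.lean`): the boxes converge in the
sense of van Hove (`tendsto_box_vanHove_holds`), so the cube limit `Φ` is also the per-site limit of `log Z^b_{Λ_n}` for
the free (`b = false`) and the wired (`b = true`) boundary condition `boxBC d b n`. [cite: Grimmett2006, Thm. (4.58)] -/
theorem tendsto_log_rcPartitionFunction_boxBC_div_card_of_cube {p q : ℝ} (hp : p ∈ Set.Icc (0 : ℝ) 1) (hq : 1 ≤ q)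
    {Φ : ℝ} (hΦ : Tendsto (fun n : ℕ =>
      Real.log (rcPartitionFunction (finsetGraph (zdGraph d) (halfOpenBox d n)) p q ∅) / (n : ℝ) ^ d) atTop (𝓝 Φ))
    (b : Bool) :
    Tendsto (fun n : ℕ =>
      Real.log (rcPartitionFunction (finsetGraph (zdGraph d) (box d n)) p q (boxBC d b n)) / (#(box d n) : ℝ))
      atTop (𝓝 Φ) := by
  cases b
  · have h := (tendsto_log_rcPartitionFunction_div_card_vanHove hp hq hΦ (d := d)).comp (tendsto_box_vanHove_holds d)
    refine h.congr fun n => ?_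
    simp [Function.comp_apply, boxBC]
  · have h := (tendsto_log_rcPartitionFunction_wired_div_card_vanHove hp hq hΦ (d := d)).comp
      (tendsto_box_vanHove_holds d)
    refine h.congr fun n => ?_
    simp [Function.comp_apply, boxBC]

/-! ### Grimmett's normalisation by the number of edges `|E_Λ|` -/

/-- `d(|Λ| − |∂ⁱⁿΛ|) ≤ |E_Λ|`: the `d` coordinate edges `⟨x, x + eᵢ⟩` issued from a point of `Λ` off the inner vertex boundary lie
inside `Λ` and are distinct. [folklore] -/
theorem mul_card_sub_card_innerBoundary_le_card_edgesIn (Λ : Finset (Site d)) :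
    d * (#Λ - #(innerBoundary (zdGraph d) Λ)) ≤ #(edgesIn (zdGraph d) Λ) := by
  classical
  have hsub : ((Λ \ innerBoundary (zdGraph d) Λ) ×ˢ (Finset.univ : Finset (Fin d))).image
      (fun xi => s(xi.1, xi.1 + Pi.single xi.2 1)) ⊆ edgesIn (zdGraph d) Λ := by
    intro e he
    rw [Finset.mem_image] at he
    obtain ⟨⟨x, i⟩, hxi, rfl⟩ := he
    obtain ⟨hxΛ, hxin⟩ := Finset.mem_sdiff.1 (Finset.mem_product.1 hxi).1
    rw [mem_edgesIn_iff]
    refine ⟨coordEdge_mem_edgeSet x i, fun z hz => ?_⟩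
    rcases Sym2.mem_iff.1 hz with rfl | rfl
    · exact hxΛ
    · by_contra hy
      exact hxin (mem_innerBoundary_iff.2 ⟨hxΛ, _, hy, (zdGraph_adj_iff _ _).2 ⟨i, Or.inl rfl⟩⟩)
  have hin : innerBoundary (zdGraph d) Λ ⊆ Λ := fun x hx => (mem_innerBoundary_iff.1 hx).1
  have h := Finset.card_le_card hsub
  rwa [Finset.card_image_of_injective _ coordEdge_injective, Finset.card_product, Finset.card_univ,
    Fintype.card_fin, Finset.card_sdiff_of_subset hin, mul_comm] at h

/-- **`|E_Λ| / |Λ| → d` along van Hove sequences** (`d|Λ| − d|∂ⁱⁿΛ| ≤ |E_Λ| ≤ d|Λ|` and `|∂ⁱⁿΛ| ≤ 2d|∂ᵉˣΛ| = o(|Λ|)`).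
[cite: Grimmett2006, proof of Thm. (4.58), (4.69)] -/
theorem tendsto_card_edgesIn_div_card_vanHove :
    Tendsto (fun Λ : Finset (Site d) => (#(edgesIn (zdGraph d) Λ) : ℝ) / #Λ) (vanHove d) (𝓝 (d : ℝ)) := by
  rw [Metric.tendsto_nhds]
  intro ε hε
  set δ : ℝ := ε / 2 / (2 * (d : ℝ) * d + 1) with hδ
  have hδ0 : 0 < δ := by positivity
  filter_upwards [(tendsto_vanHove_iff.1 tendsto_id) δ hδ0 ({0} : Finset (Site d))] with Λ hΛ
  obtain ⟨h0, hbd⟩ := hΛ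
  have hne : Λ.Nonempty := ⟨0, h0 (Finset.mem_singleton_self 0)⟩
  have hL0 : (0 : ℝ) < #Λ := by exact_mod_cast hne.card_pos
  have hup : (#(edgesIn (zdGraph d) Λ) : ℝ) ≤ d * #Λ := by exact_mod_cast card_edgesIn_le_mul_card Λ
  have hin : #(innerBoundary (zdGraph d) Λ) ≤ #Λ :=
    Finset.card_le_card fun x hx => (mem_innerBoundary_iff.1 hx).1
  have hlow : (d : ℝ) * (#Λ - #(innerBoundary (zdGraph d) Λ)) ≤ #(edgesIn (zdGraph d) Λ) := by
    have h := mul_card_sub_card_innerBoundary_le_card_edgesIn Λ (d := d)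
    have hcast : ((d * (#Λ - #(innerBoundary (zdGraph d) Λ)) : ℕ) : ℝ) =
        (d : ℝ) * (#Λ - #(innerBoundary (zdGraph d) Λ)) := by
      push_cast [Nat.cast_sub hin]
      ring
    rw [← hcast]
    exact_mod_cast h
  have hinb : (#(innerBoundary (zdGraph d) Λ) : ℝ) ≤ 2 * d * #(outerBoundary (zdGraph d) Λ) := by
    exact_mod_cast card_innerBoundary_le_two_mul_card_outerBoundary Λ
  have h3 : (#(outerBoundary (zdGraph d) Λ) : ℝ) ≤ δ * #Λ := by simpa using hbd
  rw [Real.dist_eq, abs_sub_lt_iff]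
  constructor
  · -- upper: `|E|/|Λ| - d ≤ 0 < ε`
    have : (#(edgesIn (zdGraph d) Λ) : ℝ) / #Λ ≤ d := by rw [div_le_iff₀ hL0]; exact hup
    linarith
  · -- lower: `d - |E|/|Λ| ≤ d |∂ⁱⁿΛ|/|Λ| ≤ 2d² δ < ε`
    rw [sub_lt_comm, lt_div_iff₀ hL0]
    have hd0 : (0 : ℝ) ≤ d := Nat.cast_nonneg d
    have e1 : (d : ℝ) * #(innerBoundary (zdGraph d) Λ) ≤ 2 * d * d * (δ * #Λ) := by
      calc (d : ℝ) * #(innerBoundary (zdGraph d) Λ) ≤ d * (2 * d * #(outerBoundary (zdGraph d) Λ)) :=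
            mul_le_mul_of_nonneg_left hinb hd0
        _ ≤ d * (2 * d * (δ * #Λ)) := by gcongr
        _ = 2 * d * d * (δ * #Λ) := by ring
    have e2 : 2 * (d : ℝ) * d * δ < ε := by
      rw [hδ, mul_div_assoc', div_lt_iff₀ (by positivity)]
      have : 0 ≤ 2 * (d : ℝ) * d * ε := by positivity
      nlinarith [hε]
    nlinarith [e1, e2, hlow, hL0]

/-- **Grimmett 2006, Thm. (4.58) in the book's normalisation (4.59)/(4.69)**: along van Hove sequences and for every family of
wired boundary sets `B_Λ ⊆ ∂ⁱⁿΛ`, `|E_Λ|⁻¹ log Z^{B_Λ}_Λ(p,q) → Φ/d`, where `Φ` is the per-site cube limit (`d ≥ 1`, `q ≥ 1`,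
`0 ≤ p ≤ 1`). [cite: Grimmett2006, Thm. (4.58), (4.69)] -/
theorem tendsto_log_rcPartitionFunction_bc_div_card_edgesIn_vanHove (hd : 0 < d) {p q : ℝ} (hp : p ∈ Set.Icc (0 : ℝ) 1)
    (hq : 1 ≤ q) {Φ : ℝ} (hΦ : Tendsto (fun n : ℕ =>
      Real.log (rcPartitionFunction (finsetGraph (zdGraph d) (halfOpenBox d n)) p q ∅) / (n : ℝ) ^ d) atTop (𝓝 Φ))
    (B : ∀ Λ : Finset (Site d), Set ↥Λ) (hB : ∀ Λ, B Λ ⊆ wiredBoundary (zdGraph d) Λ) :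
    Tendsto (fun Λ : Finset (Site d) =>
      Real.log (rcPartitionFunction (finsetGraph (zdGraph d) Λ) p q (B Λ)) / (#(edgesIn (zdGraph d) Λ) : ℝ))
      (vanHove d) (𝓝 (Φ / d)) := by
  have hd0 : (d : ℝ) ≠ 0 := by exact_mod_cast hd.ne'
  have h1 := tendsto_log_rcPartitionFunction_bc_div_card_vanHove hp hq hΦ B hB (d := d)
  have h2 := (tendsto_card_edgesIn_div_card_vanHove (d := d)).inv₀ hd0
  have h := h1.mul h2
  rw [← div_eq_mul_inv] at h
  refine h.congr' ?_
  filter_upwards [(tendsto_vanHove_iff.1 tendsto_id) 1 one_pos ({0} : Finset (Site d))] with Λ hΛ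
  have hne : Λ.Nonempty := ⟨0, hΛ.1 (Finset.mem_singleton_self 0)⟩
  have hL0 : (#Λ : ℝ) ≠ 0 := by exact_mod_cast hne.card_pos.ne'
  rw [inv_div, div_mul_div_comm, mul_comm (Real.log _), ← div_mul_div_comm, div_self hL0, one_mul]

end Summit.CriticalPhenomena.PercolationContinuityZ3.Theorems.FK
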